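import Literature.MathematicalPhysics.QuantumFieldTheory.Balaban1983to89.B9Cor35GDirAtCubeLetters
import Literature.MathematicalPhysics.QuantumFieldTheory.Balaban1983to89.B9Eq3115KnitCubeLetterY

/-!
# `Balaban1983to89.B9Cor35GDirAtKnitCubeLetters` — T. Bałaban, *Propagators for lattice gauge theories in a background field*, Commun. Math. Phys. **99** (1985)
# 389–434 [Balaban1985BackgroundPropagators], (3.82)–(3.84) p. 407 with (3.26) p. 395 and p. 409 l. 1–5: THE (3.82)∕(3.84) REMAINDER SPLIT AT PRINT's DIRICHLET BOND
# LETTER (C) OF THE CUBE SEQUENCE FOR A GENERIC CUBE-INDEXED AVERAGING PAIR, and its instance at the KNIT pair of record `(QknitCubeY, QsknitCubeY)` — the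
# averaging piece `avgPieceCKnit` and ★ `dirB_split_CK` (HAND (s3-a), director-ym №617 (2), dag-n06-d g34)

statement-level skeleton of published theorems with citation tags; proofs where landed; nothing here is a claim about the Yang–Mills mass gap

THE PRINT.  p. 407, (3.82)–(3.84): the remainder of Theorem 3.4's second resolvent identity at `G(U′)`, «G(U′) = G(U) − G(U)(Δ_a(U′) − Δ_a(U))G(U′)», split as «[Δ(U′) − Δ(U)]
+ [D′R′D′* − DRD*] + [Q*(U′)aQ(U′) − Q*(U)aQ(U)]»; (3.26) p. 395 «Δ_a = Δ + DRD* + Q*aQ»; p. 409 l. 1–5 «The operators constructed for this sequence {Ω_n(□)}, which we denote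
by G′_□(U), C_□(U), G_□(U)»; (3.12)–(3.15) p. 393 (the composite averaging `Q(U)` of a sequence).

WHY THIS FILE (cell `pub-ymgap`, node N06).  dag-n06-c's ✓`B9Cor35GDirAtCubeLetters` §4 splits the (3.84) remainder at the (C) letter for r05's STRAIGHT-contour cube pair
`(QCubeY parB, QsCubeY parB)` (`dirB_split_C`, averaging piece `avgPieceCK`), and its `h385_dirB_of_pieces` ∕ `cor35_GDir_of_pieces` take the averaging word `AV` as an
abstract summand with a (3.83)-shaped majorant `hAv`.  dag-n06-d g34 re-keyed the heads' bond letter of record to the cube sequence's KNIT pair `(QknitCubeY i □,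
QsknitCubeY i □)` (✓`B9Eq3115KnitCubeLetterY`; `Δ_{loc,□}[𝔮_□]` = ✓`B9DirichletBondCubePairY.deltaLocCQY`).  THIS FILE re-presses the split ONCE for a GENERIC
cube-indexed pair `(𝔮_□, 𝔮⋆_□)` (§1) and names the knit instance (§2) — the `AV` slot of dag-n06-c's FILE 4 at the letter of record.  Its smallness ((3.80)–(3.83) for
`QknitCubeY`, HAND (s3-b)) is the next file.

WHAT IS DEFINED AND PROVED (sorry-free; one `def` with body + one `abbrev`; theorems by `rfl` ∕ `abel`).
* §1 `avgPieceCQK b i □ 𝔮_□ 𝔮⋆_□ V := conj b((𝔮⋆_□(1) a_□ 𝔮_□(1) − 𝔮⋆_□(V) a_□ 𝔮_□(V))♯ℝ)`; `avgPieceCQK_QCubeY` (= dag-n06-c's `avgPieceCK` at the straight pair, `rfl`);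
  ★ `dirB_split_CQ (V) : conj b(((deltaLocCQY i □ 𝔮_□ 𝔮⋆_□ 1 − DPDsDirCubeY i □ S 1) − (deltaLocCQY … V − DPDsDirCubeY i □ S V))♯ℝ) = lapPieceK b i V + projPieceDirK b i □ S V +
  avgPieceCQK b i □ 𝔮_□ 𝔮⋆_□ V` (dag-n06-c's proof verbatim, `deltaLocCubeY ↦ deltaLocCQY`).
* §2 (`𝔸 = M_N(ℂ)`) `avgPieceCKnit b i □ V := avgPieceCQK b i □ (QknitCubeY i □) (QsknitCubeY i □) V` (`abbrev`), ★ `dirB_split_CK` (the split at the knit pair of record).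
HONEST SCOPE.  Finite-dimensional algebra (identities only); no estimate — the (3.83)-shaped majorant of `avgPieceCKnit` is NOT here; nothing of Theorem 3.4 ∕ Cor. 3.5
asserted; no letter of another seat modified.  COUNT-NEUTRAL (`--supports stmt-QuantumFields-27364`); N06 NOT discharged; K1⁹ NOT closed; nothing continuum ∕ ℝ⁴ ∕ OS ∕
mass gap ∕ Clay — the Yang–Mills mass gap is NOT proved here.  NEW file; nothing landed is modified.  No `sorry`, no `axiom`, no `instance`, no `notation`.  Net new
unproved facts: 0.  Seat `pub-ymgap-dag-n06-j` (g39), 2026-08-31.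
RELATED, NOT DUPLICATED (searched 2026-08-31: `rg 'avgPieceCKnit|avgPieceCQK|dirB_split_CK|dirB_split_CQ'` over `Literature ∕ Summits` = ∅): dag-n06-c `B9Cor35GDirAtCubeLetters`
(`avgPieceCK`, `dirB_split_C`, `projPieceDirK`), r05 `B9Cor35GAtCubeLetters` (`lapPieceK`), r05 `B9Cor35GCubeAvgPiece` (`avgPieceK`) — all used by name.
-/

noncomputable section

namespace Literature.MathematicalPhysics.QuantumFieldTheory.Balaban1983to89.B9Cor35GDirAtKnitCubeLetters

open B9Eq352DivFormLetters (conj)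
open B6KLevelCensusIndexV1 (KIdx)
open B6Cover236MultiLevelBlocks (cubes)
open B9CubeLettersBondOpsL0 (BlkCubeY QCubeY QsCubeY aCubeY)
open B9Cor36GpCubeEntriesAtV (conj_add')
open B9Cor35GAtCubeLetters (lapPieceK)
open B9Cor35GDirAtCubeLetters (projPieceDirK avgPieceCK)
open B9DirichletBondCubePairY (QCLetterY QCsLetterY deltaLocCQY)
open B9Eq3115KnitCubeLetterY (QknitCubeY QsknitCubeY)
open Node00 (SiteY FBondY CfgY BondParY toKT hessY gradY divY)
open Node00.OpsYCubeProjectionG (DPDsDirCubeY)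
open scoped Matrix

variable {d ℓ : ℕ} {hd : 1 ≤ d + 1} {hL : Odd (ℓ + 1) ∧ 1 < ℓ + 1} {b₀ b₁ : ℝ}

/-! ## §1 The split for a generic cube-indexed averaging pair -/

section GenericPair

variable {𝔸 : Type} [NormedRing 𝔸] [NormedAlgebra ℂ 𝔸] [CompleteSpace 𝔸]
variable {ι : Type} [Fintype ι] (b : Module.Basis ι ℝ 𝔸)
variable (i : KIdx d ℓ hd hL b₀ b₁) (q : ↥(cubes (toKT i).D.toDomains)) (𝔮c : QCLetterY 𝔸 i q) (𝔮cs : QCsLetterY 𝔸 i q) (S : Finset (SiteY i))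

/-- **the realified AVERAGING PIECE of the cube sequence at a GENERIC cube-indexed pair** `conj b((𝔮⋆_□(1) a_□ 𝔮_□(1) − 𝔮⋆_□(Ṽ) a_□ 𝔮_□(Ṽ))♯ℝ)` (dag-n06-c's `avgPieceCK`
is the instance at r05's straight-contour pair). [cite: Balaban1985BackgroundPropagators, (3.80)–(3.83) p.407, (3.26) p.395, p.409 l.1–5] -/
def avgPieceCQK (V : CfgY 𝔸 i) : Module.End ℝ (FBondY i × ι → ℝ) :=
  conj b ((𝔮cs 1 ∘ₗ aCubeY i q ∘ₗ 𝔮c 1 - 𝔮cs V ∘ₗ aCubeY i q ∘ₗ 𝔮c V).restrictScalars ℝ)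

/-- at r05's straight-contour pair the generic averaging piece IS dag-n06-c's `avgPieceCK` (definitionally).
[cite: Balaban1985BackgroundPropagators, (3.82) p.407, bookkeeping] -/
theorem avgPieceCQK_QCubeY (parB : BondParY 𝔸 i) (V : CfgY 𝔸 i) :
    avgPieceCQK b i q (QCubeY i q parB) (QsCubeY i q parB) V = avgPieceCK b i q parB V := rfl

/-- ★ **(3.82)∕(3.84) SPLIT BY LETTER AT THE DIRICHLET BOND LETTER (C), GENERIC CUBE PAIR**: for `T U := Δ_{loc,□}[𝔮_□](U) − DP_□(U)D*`
(`deltaLocCQY i □ 𝔮_□ 𝔮⋆_□ U − DPDsDirCubeY i □ S U`), `conj b((T(1) − T(Ṽ))♯) = [Δ(1) − Δ(Ṽ)] + [D₁P-part] + [𝔮⋆_□(1)a𝔮_□(1) − 𝔮⋆_□(Ṽ)a𝔮_□(Ṽ)]` realified — r05's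
`lapPieceK`, dag-n06-c's `projPieceDirK`, `avgPieceCQK` (dag-n06-c's `dirB_split_C` with the pair generic).
[cite: Balaban1985BackgroundPropagators, (3.82)–(3.84) p.407, (3.26) p.395, p.409 l.3–5] -/
theorem dirB_split_CQ (V : CfgY 𝔸 i) :
    conj b (((deltaLocCQY i q 𝔮c 𝔮cs (fun _ _ => 1) - DPDsDirCubeY i q S (fun _ _ => 1)) -
        (deltaLocCQY i q 𝔮c 𝔮cs V - DPDsDirCubeY i q S V)).restrictScalars ℝ) =
      lapPieceK b i V + projPieceDirK b i q S V + avgPieceCQK b i q 𝔮c 𝔮cs V := by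
  have e1 : (1 : CfgY 𝔸 i) = fun _ _ => 1 := rfl
  have e : (deltaLocCQY i q 𝔮c 𝔮cs (fun _ _ => 1) - DPDsDirCubeY i q S (fun _ _ => 1)) -
        (deltaLocCQY i q 𝔮c 𝔮cs V - DPDsDirCubeY i q S V) =
      (hessY i (fun _ _ => 1) - hessY i V) +
        (gradY i (fun _ _ => 1) ∘ₗ divY i (fun _ _ => 1) - DPDsDirCubeY i q S (fun _ _ => 1) - (gradY i V ∘ₗ divY i V - DPDsDirCubeY i q S V)) +
        (𝔮cs 1 ∘ₗ aCubeY i q ∘ₗ 𝔮c 1 - 𝔮cs V ∘ₗ aCubeY i q ∘ₗ 𝔮c V) := by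
    rw [e1]; simp only [deltaLocCQY]; abel
  have e2 : (((deltaLocCQY i q 𝔮c 𝔮cs (fun _ _ => 1) - DPDsDirCubeY i q S (fun _ _ => 1)) -
        (deltaLocCQY i q 𝔮c 𝔮cs V - DPDsDirCubeY i q S V)).restrictScalars ℝ) =
      (hessY i (fun _ _ => 1) - hessY i V).restrictScalars ℝ +
        (gradY i (fun _ _ => 1) ∘ₗ divY i (fun _ _ => 1) - DPDsDirCubeY i q S (fun _ _ => 1) -
          (gradY i V ∘ₗ divY i V - DPDsDirCubeY i q S V)).restrictScalars ℝ +
        (𝔮cs 1 ∘ₗ aCubeY i q ∘ₗ 𝔮c 1 - 𝔮cs V ∘ₗ aCubeY i q ∘ₗ 𝔮c V).restrictScalars ℝ := by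
    rw [e]; exact LinearMap.ext fun _ => rfl
  rw [lapPieceK, projPieceDirK, avgPieceCQK, e2, conj_add', conj_add']

end GenericPair

/-! ## §2 The knit pair of record `(QknitCubeY i □, QsknitCubeY i □)` over `M_N(ℂ)` -/

section KnitPair

open scoped Matrix.Norms.L2Operator

variable {N : ℕ} [Nonempty (Fin N)] {ι : Type} [Fintype ι] (b : Module.Basis ι ℝ (Matrix (Fin N) (Fin N) ℂ))
variable (i : KIdx d ℓ hd hL b₀ b₁) (q : ↥(cubes (toKT i).D.toDomains)) (S : Finset (SiteY i))

/-- ★ **THE KNIT-PAIR AVERAGING PIECE of the cube sequence** `conj b((Q*_□(1)a_□Q_□(1) − Q*_□(Ṽ)a_□Q_□(Ṽ))♯ℝ)` at the letter of record `(QknitCubeY i □, QsknitCubeY i □)` —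
the `AV` slot of dag-n06-c's `h385_dirB_of_pieces` ∕ `cor35_GDir_of_pieces` at the (C) letter of the N06 heads.
[cite: Balaban1985BackgroundPropagators, (3.80)–(3.83) p.407, (3.12)–(3.15) p.393, p.409 l.1–5] -/
abbrev avgPieceCKnit (V : CfgY (Matrix (Fin N) (Fin N) ℂ) i) : Module.End ℝ (FBondY i × ι → ℝ) :=
  avgPieceCQK b i q (QknitCubeY i q) (QsknitCubeY i q) V

/-- ★ **(3.82)∕(3.84) SPLIT AT THE KNIT PAIR OF RECORD**: for `T U := deltaLocCQY i □ (QknitCubeY i □) (QsknitCubeY i □) U − DPDsDirCubeY i □ S U`,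
`conj b((T(1) − T(Ṽ))♯ℝ) = lapPieceK b i Ṽ + projPieceDirK b i □ S Ṽ + avgPieceCKnit b i □ Ṽ`.
[cite: Balaban1985BackgroundPropagators, (3.82)–(3.84) p.407, (3.26) p.395, p.409 l.1–5] -/
theorem dirB_split_CK (V : CfgY (Matrix (Fin N) (Fin N) ℂ) i) :
    conj b (((deltaLocCQY i q (QknitCubeY i q) (QsknitCubeY i q) (fun _ _ => 1) - DPDsDirCubeY i q S (fun _ _ => 1)) -
        (deltaLocCQY i q (QknitCubeY i q) (QsknitCubeY i q) V - DPDsDirCubeY i q S V)).restrictScalars ℝ) =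
      lapPieceK b i V + projPieceDirK b i q S V + avgPieceCKnit b i q V :=
  dirB_split_CQ b i q (QknitCubeY i q) (QsknitCubeY i q) S V

end KnitPair

end Literature.MathematicalPhysics.QuantumFieldTheory.Balaban1983to89.B9Cor35GDirAtKnitCubeLetters

end
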